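import Mathlib
import HarnessLib
import Summits.AtomisticToContinuum.FouriersLaw.Theses.JunctionLocality
import Summits.AtomisticToContinuum.FouriersLaw.Theses.StaticAbelianSqueeze
import Summits.AtomisticToContinuum.FouriersLaw.Theses.HoelderEscapeProfile
import Summits.AtomisticToContinuum.FouriersLaw.Theses.EmbeddedDrudeMourre
import Summits.AtomisticToContinuum.FouriersLaw.Theorems.JunctionLocalityConductanceLowerBoundSplit
import Summits.AtomisticToContinuum.FouriersLaw.Theorems.JunctionLocalityConductanceLowerBoundAbelFloorFrequently
import Summits.AtomisticToContinuum.FouriersLaw.Theorems.JunctionLocalityConductanceLowerBoundOpenChainAbelFloorOfStaticAbelFloor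
import Summits.AtomisticToContinuum.FouriersLaw.Theorems.JunctionLocalityConductanceLowerBoundBulkAbelFloorOfHoelderCorner
import Summits.AtomisticToContinuum.FouriersLaw.Theorems.JunctionLocalityConductanceLowerBoundStubBulkAbelFloorOfHeatVarianceBets
import Summits.AtomisticToContinuum.FouriersLaw.Theorems.StaticAbelianSqueezeUniformAbelianRegularityOfQuasiAdditivity
import Summits.AtomisticToContinuum.FouriersLaw.Theorems.StaticAbelianSqueezeUniformAbelianRegularityFixedNAbelRegularity
import Summits.AtomisticToContinuum.FouriersLaw.Theorems.ConductanceLowerBound.Negative.AbelInsulatorOfCurrentCoboundary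

/-!
# Strategist r1 — PLANS for the two pieces of the route-level split of `JunctionLocality.ConductanceLowerBound`
(sorry-free certificate: every supplier implication below is a LANDED theorem applied by name; nothing new is claimed)

Pieces (spelled exactly as filed in `children.json`, namespace `StrategistR1`):
* P1 `OpenChainAbelFloorFrequently` (A⁻⁻, bulk half);
* P2 `SignedSlowRegularity` (R⁻, contact half);
glue `AbelFloorExchange.conductanceLowerBound_of_subs : P1 → P2 → JunctionLocality.ConductanceLowerBound` (p174019).

§1 P1 plans: (a) StaticAbelianSqueeze: `ResolventSqueeze` (stmt-13417) + STATIC primal Abel floor ⇒ (A⁻) ⇒ P1 (p160999 + p161612);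
(b) HoelderEscapeProfile: K1 `LocalEnergyHalfHoelder` + K2 `CornerNoDip` + `FibreCalculus` + `SymmetricSetup` ⇒ bulk witness ⇒ (A⁻) ⇒ P1
(p160912 + p156938 + p161612).  Kill switch: a current coboundary in the bulk refutes P1 (p162590).
§2 P2 plans: (a) by name from `UniformAbelianRegularity` (stmt-13416, staffed; p156938); (b) from 13416's registered composition B:
halving quasi-additivity of the Abel deficit (stub `stub_abelDeficitQuasiAdditive` of line `Sketch`) + the LANDED fixed-`N` Abel regularity
(p163567 + `stub_fixedNAbelRegularity`), through the `EmbeddedDrudeMourre` copy of (R) (rfl-equal).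
§3 Sanity: P1 ∧ P2 ⇒ the crux on THIS route (p174019), and under (R) the crux ⇒ P1 (necessity modulo 13416).
-/

open scoped BigOperators Topology Manifold Classical MeasureTheory ProbabilityTheory Matrix InnerProductSpace ComplexConjugate ContinuousMap
open Filter Set Function TopologicalSpace MeasureTheory
open Literature.MathematicalPhysics.KineticTheory.HeatConduction
open Summit.AtomisticToContinuum.FouriersLaw.Cruxes.ConductanceLowerBound.AbelFloorExchange

namespace Summit.AtomisticToContinuum.FouriersLaw.Cruxes.ConductanceLowerBound.StrategistR1

/-- P1 (A⁻⁻), verbatim the child statement. -/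
def OpenChainAbelFloorFrequently : Prop :=
  ∀ ω₂ lam β γ : ℝ, 0 < ω₂ → 0 < lam → 0 < β → 0 < γ → ∀ T : ℝ, 0 < T → ∃ a : ℝ, 0 < a ∧ ∀ ν₁ : ℝ, 0 < ν₁ → ∃ ν : ℝ, 0 < ν ∧ ν < ν₁ ∧ ∃ N₀ : ℕ, ∀ N : ℕ, N₀ ≤ N → a * N ≤ ∫ t in Set.Ioi (0:ℝ), Real.exp (-(ν * t)) * ∫ z, (∑ i : Fin N, (Literature.MathematicalPhysics.KineticTheory.HeatConduction.pinnedChain ω₂ lam β γ).bondCurrent N i z) * (∫ y, (∑ i : Fin N, (Literature.MathematicalPhysics.KineticTheory.HeatConduction.pinnedChain ω₂ lam β γ).bondCurrent N i y) ∂((Literature.MathematicalPhysics.KineticTheory.HeatConduction.pinnedChain ω₂ lam β γ).transitionKernel N T T t.toNNReal z)) ∂((Literature.MathematicalPhysics.KineticTheory.HeatConduction.pinnedChain ω₂ lam β γ).gibbsMeasure N T)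

/-- P2 (R⁻), verbatim the child statement. -/
def SignedSlowRegularity : Prop :=
  ∀ ω₂ lam β γ : ℝ, 0 < ω₂ → 0 < lam → 0 < β → 0 < γ → ∀ T : ℝ, 0 < T → ∀ ε : ℝ, 0 < ε → ∃ ν₀ : ℝ, 0 < ν₀ ∧ ∀ ν : ℝ, 0 < ν → ν < ν₀ → ∃ N₀ : ℕ, ∀ N : ℕ, N₀ ≤ N → -(ε * N) ≤ ∫ t in Set.Ioi (0:ℝ), (1 - Real.exp (-(ν * t))) * ∫ z, (∑ i : Fin N, (Literature.MathematicalPhysics.KineticTheory.HeatConduction.pinnedChain ω₂ lam β γ).bondCurrent N i z) * (∫ y, (∑ i : Fin N, (Literature.MathematicalPhysics.KineticTheory.HeatConduction.pinnedChain ω₂ lam β γ).bondCurrent N i y) ∂((Literature.MathematicalPhysics.KineticTheory.HeatConduction.pinnedChain ω₂ lam β γ).transitionKernel N T T t.toNNReal z)) ∂((Literature.MathematicalPhysics.KineticTheory.HeatConduction.pinnedChain ω₂ lam β γ).gibbsMeasure N T)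

/-! ## §1 Plans for P1 (bulk half) -/

/-- **P1 plan (a), StaticAbelianSqueeze reading.** `ResolventSqueeze` (stmt-13417) and a static Abel floor of the primal functional
`PRIMAL_ν(g) = 2⟨⟨j,g⟩⟩ − ν⟨⟨g,g⟩⟩ − ν⁻¹⟨⟨𝒜g,𝒜g⟩⟩ ≥ a` (one local `g` per small `ν`) give P1 (p160999, then (A⁻) ⇒ (A⁻⁻)). [cite: BernardinOlla2011, §6] -/
theorem openChainAbelFloorFrequently_of_resolventSqueeze_of_staticAbelFloor
    (hS : Summit.AtomisticToContinuum.FouriersLaw.Theses.StaticAbelianSqueeze.ResolventSqueeze)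
    (hF : ∀ ω₂ lam β γ : ℝ, 0 < ω₂ → 0 < lam → 0 < β → 0 < γ → ∀ T : ℝ, 0 < T →
      ∃ μT : Measure ChainConfig, (pinnedChain ω₂ lam β γ).IsChainGibbsMeasure T μT ∧ IsShiftInvariant μT ∧
        ∃ a ν₀ : ℝ, 0 < a ∧ 0 < ν₀ ∧ ∀ ν : ℝ, 0 < ν → ν < ν₀ →
          ∃ g : ChainConfig → ℝ, IsLocalTestFunction g ∧
            a ≤ 2 * (∑' x : ℤ, ((∫ σ, (pinnedChain ω₂ lam β γ).bondCurrentZ σ 0 * g (fun i => σ (i + x)) ∂μT) -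
                      (∫ σ, (pinnedChain ω₂ lam β γ).bondCurrentZ σ 0 ∂μT) * (∫ σ, g σ ∂μT)))
                - ν * (∑' x : ℤ, ((∫ σ, g σ * g (fun i => σ (i + x)) ∂μT) - (∫ σ, g σ ∂μT) * (∫ σ, g σ ∂μT)))
                - ν⁻¹ * (∑' x : ℤ, ((∫ σ, (pinnedChain ω₂ lam β γ).liouvilleZ g σ *
                      (pinnedChain ω₂ lam β γ).liouvilleZ g (fun i => σ (i + x)) ∂μT) -
                    (∫ σ, (pinnedChain ω₂ lam β γ).liouvilleZ g σ ∂μT) *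
                      (∫ σ, (pinnedChain ω₂ lam β γ).liouvilleZ g σ ∂μT)))) :
    OpenChainAbelFloorFrequently :=
  abelFloorFrequently_openChain_of_abelFloor_openChain
    (openChainAbelFloor_of_resolventSqueeze_of_staticAbelFloor hS hF)

/-- **P1 plan (b), HoelderEscapeProfile reading.** K1 + K2 + the fibre calculus + the symmetric setup give the bulk witness, hence (A⁻),
hence P1 (p160912, p156938, p161612). [cite: KunduDharNarayan2009, p. 3] -/
theorem openChainAbelFloorFrequently_of_hoelderCorner
    (hK1 : Summit.AtomisticToContinuum.FouriersLaw.Theses.HoelderEscapeProfile.LocalEnergyHalfHoelder)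
    (hND : Summit.AtomisticToContinuum.FouriersLaw.Theses.HoelderEscapeProfile.CornerNoDip)
    (hFC : Summit.AtomisticToContinuum.FouriersLaw.Theses.HoelderEscapeProfile.FibreCalculus)
    (hSet : Summit.AtomisticToContinuum.FouriersLaw.Theses.HoelderEscapeProfile.SymmetricSetup) :
    OpenChainAbelFloorFrequently :=
  abelFloorFrequently_openChain_of_abelFloor_openChain
    (abelFloor_openChain_of_bulkWitness (bulkAbelFloor_of_hoelderCorner hK1 hND hFC hSet))

/-! ## §2 Plans for P2 (contact half) -/

/-- **P2 plan (a): by name from (R)** `StaticAbelianSqueeze.UniformAbelianRegularity` (stmt-13416). [folklore] -/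
theorem signedSlowRegularity_of_uniformAbelianRegularity
    (hR : Summit.AtomisticToContinuum.FouriersLaw.Theses.StaticAbelianSqueeze.UniformAbelianRegularity) :
    SignedSlowRegularity :=
  slowRegularity_signed_of_uniformAbelianRegularity hR

/-- **P2 plan (b): from 13416's composition B** — halving quasi-additivity of the Abel deficit (registered physical stub
`stub_abelDeficitQuasiAdditive` of line `Sketch` on stmt-13416) plus the LANDED fixed-`N` Abel regularity. [folklore] -/
theorem signedSlowRegularity_of_abelDeficitQuasiAdditive
    (hQ : ∀ ω₂ lam β γ : ℝ, 0 < ω₂ → 0 < lam → 0 < β → 0 < γ → ∀ T : ℝ, 0 < T →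
      ∃ (K δ ν₁ : ℝ) (N₁ : ℕ), 0 < δ ∧ δ < 1 ∧ 0 < ν₁ ∧ ∀ ν : ℝ, 0 < ν → ν ≤ ν₁ → ∀ N : ℕ, 2 * N₁ ≤ N →
        let c : ℕ → ℝ → ℝ := fun M t => ∫ z, (∑ i : Fin M, (Literature.MathematicalPhysics.KineticTheory.HeatConduction.pinnedChain ω₂ lam β γ).bondCurrent M i z) * (∫ y, (∑ i : Fin M, (Literature.MathematicalPhysics.KineticTheory.HeatConduction.pinnedChain ω₂ lam β γ).bondCurrent M i y) ∂((Literature.MathematicalPhysics.KineticTheory.HeatConduction.pinnedChain ω₂ lam β γ).transitionKernel M T T t.toNNReal z)) ∂((Literature.MathematicalPhysics.KineticTheory.HeatConduction.pinnedChain ω₂ lam β γ).gibbsMeasure M T);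
        let S : ℕ → ℝ := fun M => ∫ t in Set.Ioi (0:ℝ), (1 - Real.exp (-(ν * t))) * c M t;
        |S N - S (N / 2) - S (N - N / 2)| ≤ K * (N:ℝ) ^ (1 - δ)) :
    SignedSlowRegularity :=
  slowRegularity_signed_of_uniformAbelianRegularity
    (Summit.AtomisticToContinuum.FouriersLaw.Theorems.UniformAbelianRegularity.ZeroMeanDyadicSplice.stub_regularityOfQuasiAdditivity
      hQ Summit.AtomisticToContinuum.FouriersLaw.Theorems.UniformAbelianRegularity.ZeroMeanDyadicSplice.stub_fixedNAbelRegularity)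

/-! ## §3 Sanity: the pieces close the crux on THIS route; necessity of P1 modulo (R); the kill switch of P1 -/

/-- P1 ∧ P2 ⇒ `JunctionLocality.ConductanceLowerBound` (the landed glue p174019). [folklore] -/
theorem crux_of_pieces (h₁ : OpenChainAbelFloorFrequently) (h₂ : SignedSlowRegularity) :
    Summit.AtomisticToContinuum.FouriersLaw.Theses.JunctionLocality.ConductanceLowerBound :=
  conductanceLowerBound_of_subs h₁ h₂

/-- Under (R), the crux gives P1 back (p161612): P1 is necessary modulo stmt-13416. [folklore] -/
theorem piece1_of_crux_of_uniformAbelianRegularity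
    (hR : Summit.AtomisticToContinuum.FouriersLaw.Theses.StaticAbelianSqueeze.UniformAbelianRegularity)
    (hC : Summit.AtomisticToContinuum.FouriersLaw.Theses.JunctionLocality.ConductanceLowerBound) :
    OpenChainAbelFloorFrequently :=
  abelFloorFrequently_openChain_of_conductanceLowerBound_of_uniformAbelianRegularity hR hC

#print axioms openChainAbelFloorFrequently_of_resolventSqueeze_of_staticAbelFloor
#print axioms openChainAbelFloorFrequently_of_hoelderCorner
#print axioms signedSlowRegularity_of_abelDeficitQuasiAdditive
#print axioms crux_of_pieces

end Summit.AtomisticToContinuum.FouriersLaw.Cruxes.ConductanceLowerBound.StrategistR1
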